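import Literature.Probability.RandomPlanarGeometry.HexSAWStripSurfaceLimit
import Literature.Probability.RandomPlanarGeometry.HexSAWBrickWallStripFugacityTwoSided
import HarnessLib

/-!
# The two-wall strip rate converges to the larger one-wall rate: `μ_T(y,z) → max(μ(y), μ(z))` as `T → ∞`

Topic `Literature/Probability/RandomPlanarGeometry` (continues `HexSAWBrickWallStripFugacityTwoSided.lean` —
`C_{T,n}(y,z) = HexBW.stripZ₂ T n y z`, `μ_T(y,z) = HexBW.stripMuY₂ T y z`, the exact symmetry `stripZ₂_symm`, the splitting map
`HexBW.split` with `bottomVisits₀_split` / `topVisits₀_split` — and `HexSAWStripSurfaceLimit.lean` — BBdGDCG14 Proposition 7,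
second sentence, for the printed one-surface weight: `HexBW.tendsto_stripMuY₀ : μ_T(y,1) → μ(y) = HV.surfaceMu y`, with the
explicit bound `HexBW.stripZ₀_le_explicit : C_{T,n}(y,1) ≤ (2(T+1)μ + μ²β(y)²) e^{22√n} μ(y)ⁿ`).

Sources.  N. R. Beaton, M. Bousquet-Mélou, J. de Gier, H. Duminil-Copin, A. J. Guttmann, Comm. Math. Phys. 326 (2014),
arXiv:1109.0358v5, §3.2: Proposition 6 (p. 10: the two-surface strip rate `μ_T(y,z)`, "non-decreasing in `y` and `z`",
`μ_T(y,z) = μ_T(z,y)`) and Proposition 7 (p. 11: "as `T → ∞`, `μ_T(1,y) → μ(y)`", proof by reference to [16] =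
E. J. Janse van Rensburg, E. Orlandini, S. G. Whittington, *Self-avoiding walks in a slab: rigorous results*, J. Phys. A 39
(2006) 13869, §§5–6, where the corresponding TWO-wall statement for slabs of `ℤ^d` — the limiting free energy of a slab with
two interacting walls is the larger of the two one-wall free energies — is proved).  For the honeycomb strip with a fugacity
on EACH surface the statement below is, as far as the lane's literature seats could determine, not printed; its proof here is
the lane's: a renewal-type recursion over the alternating first visits to the two surfaces.

## Statement and mechanism (namespace `Literature.Probability.RandomPlanarGeometry.SAW.HexBW`, all PROVED)

* §1 LOWER BOUNDS by sub-strips: `stripZ₀_le_stripZ₂_succ` (`C_{T,n}(y,1) ≤ C_{T+1,n}(y,z)`: a walk of `S_T ⊂ S_{T+1}` never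
  meets the top surface of `S_{T+1}`), **`stripMuY₀_le_stripMuY₂_succ : μ_T(y,1) ≤ μ_{T+1}(y,z)`** and, by the symmetry,
  `stripMuY₀_le_stripMuY₂_succ' : μ_T(z,1) ≤ μ_{T+1}(y,z)`.
* §2 ROOTED partition functions `botZ₂` / `topZ₂` (strip walks starting at the bottom-surface vertex `botRoot = (1,0)` / at the
  top-surface vertex `topRoot T = (T mod 2, T)` of the cross-section), `botZ₂_le_topZ₂_swap` (reflection), the first top-surface
  time `firstTop`, and the two CUTS at the first visit to the other surface (the tree's `HexBW.split`, exact weight bookkeeping):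
  **`stripZ₂_le_cut_top`** — `C_{T,n}(y,z) ≤ C_{T,n}(y,1) + Σ_{m ≤ n} C_{T,m}(y,1) · D^top_{n−m}(y,z)`,
  **`topZ₂_le_cut_bot`** — `D^top_n(y,z) ≤ C_{T,n}(z,1) + Σ_{T ≤ m ≤ n} C_{T,m}(z,1) · D^top_{n−m}(z,y)` (a walk needs at least
  `T` steps from one surface to the other).
* §3 the RENEWAL INDUCTION: with `P_m := max(C_{T,m}(y,1), C_{T,m}(z,1)) ≤ K_T e^{22√m} Mᵐ`, `M := max(μ(y), μ(z))`, the
  symmetrised rooted function `E_n := max(D^top_n(y,z), D^top_n(z,y))` obeys `E_n ≤ P_n + Σ_{m=T}^{n} P_m E_{n−m}`, whence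
  `E_n ≤ A (θλM)ⁿ` as soon as `K λ^{−T} λ/(λ−1) ≤ 1/2` (`eventually_rootZ₂_le`), and `C_{T,n}(y,z) ≤ K' (θλM)ⁿ`;
  **`eventually_stripMuY₂_le : ∀ t > 1, ∀ᶠ T, μ_T(y,z) ≤ t · max(μ(y), μ(z))`**.
* §4 ★ **`tendsto_stripMuY₂_atTop : Tendsto (fun T => μ_T(y,z)) atTop (𝓝 (max (μ(y)) (μ(z))))`** for all `y, z > 0`, and the
  corollaries `tendsto_stripMuY₂_of_le` (both `≤ 1+√2`: limit `μ`), `tendsto_stripMuY₂_of_lt_left` (`y > 1+√2 ≥ z`-type: limit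
  `β(y)`).
-/

noncomputable section

open Filter Topology Finset Literature.Probability.LatticeModels Literature.Probability.Percolation SimpleGraph

namespace Literature.Probability.RandomPlanarGeometry.SAW.HexBW

open Literature.Probability.RandomPlanarGeometry.SAW.HexBW.Wall

variable {T n : ℕ} {y z : ℝ}

/-! ### §1 Lower bounds by sub-strips -/

/-- A walk of `S_T` is a walk of `S_{T+1}` with the same bottom-surface visits and NO top-surface visit of `S_{T+1}`.
[cite: MadrasSlade1993, §8.2, eq. (8.2.1) (S_T ⊆ S_{T+1}); BeatonBousquetMelouDeGierDuminilCopinGuttmann2014, §3.2 (arXiv v5 p. 10)] -/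
theorem mem_stripPairs_succ_of_mem {p : Site 2 × (ℕ → Site 2)} (hp : p ∈ stripPairs T n) :
    p ∈ stripPairs (T + 1) n ∧ topVisits₀ (T + 1) p.1 p.2 n = 0 := by
  obtain ⟨ha, hυ, hbw, hstrip⟩ := mem_stripPairs.1 hp
  refine ⟨mem_stripPairs.2 ⟨stripStarts_mono (Nat.le_succ T) ha, hυ, hbw, fun m hm => (hstrip m hm).mono (Nat.le_succ T)⟩,
    Finset.sum_eq_zero fun m hm => ?_⟩
  have h := (hstrip m (Nat.lt_succ_iff.1 (Finset.mem_range.1 hm))).2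
  rw [if_neg]
  push_cast
  omega

/-- **`C_{T,n}(y,1) ≤ C_{T+1,n}(y,z)`** for `y ≥ 0`, `z` arbitrary (the embedded walks carry the weight `z⁰`).
[cite: BeatonBousquetMelouDeGierDuminilCopinGuttmann2014, Proposition 6 (arXiv v5 p. 10); MadrasSlade1993, §8.2, eq. (8.2.1)] -/
theorem stripZ₀_le_stripZ₂_succ (T n : ℕ) (hy : 0 ≤ y) (hz : 0 ≤ z) : stripZ₀ T n y ≤ stripZ₂ (T + 1) n y z := by
  unfold stripZ₀ stripZ₂
  have hsub : stripPairs T n ⊆ stripPairs (T + 1) n := fun p hp => (mem_stripPairs_succ_of_mem hp).1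
  calc ∑ p ∈ stripPairs T n, y ^ bottomVisits₀ p.1 p.2 n
      = ∑ p ∈ stripPairs T n, y ^ bottomVisits₀ p.1 p.2 n * z ^ topVisits₀ (T + 1) p.1 p.2 n :=
        Finset.sum_congr rfl fun p hp => by rw [(mem_stripPairs_succ_of_mem hp).2, pow_zero, mul_one]
    _ ≤ ∑ p ∈ stripPairs (T + 1) n, y ^ bottomVisits₀ p.1 p.2 n * z ^ topVisits₀ (T + 1) p.1 p.2 n :=
        Finset.sum_le_sum_of_subset_of_nonneg hsub fun p _ _ => mul_nonneg (pow_nonneg hy _) (pow_nonneg hz _)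

/-- **`μ_T(y,1) ≤ μ_{T+1}(y,z)`** (`y, z > 0`): the bottom wall alone, in a sub-strip.
[cite: BeatonBousquetMelouDeGierDuminilCopinGuttmann2014, Proposition 6 (arXiv v5 p. 10: μ_T(y,z) non-decreasing) and Proposition 7 (p. 11)] -/
theorem stripMuY₀_le_stripMuY₂_succ (T : ℕ) (hy : 0 < y) (hz : 0 < z) : stripMuY₀ T y ≤ stripMuY₂ (T + 1) y z := by
  refine le_ciInf fun n => ?_
  refine (stripMuY₀_le_rpow T hy (Nat.succ_ne_zero n)).trans ?_
  rw [Nat.cast_succ]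
  have hK0 : 0 ≤ yK y := by linarith [one_le_yK y]
  have hK1 : 1 ≤ yK z := one_le_yK z
  refine Real.rpow_le_rpow (mul_nonneg hK0 (stripZ₀_pos T _ hy).le) ?_ (by positivity)
  calc yK y * stripZ₀ T (n + 1) y ≤ yK y * stripZ₂ (T + 1) (n + 1) y z :=
        mul_le_mul_of_nonneg_left (stripZ₀_le_stripZ₂_succ T (n + 1) hy.le hz.le) hK0
    _ = yK y * 1 * stripZ₂ (T + 1) (n + 1) y z := by ring
    _ ≤ yK y * yK z * stripZ₂ (T + 1) (n + 1) y z :=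
        mul_le_mul_of_nonneg_right (mul_le_mul_of_nonneg_left hK1 hK0) (stripZ₂_pos _ _ hy hz).le

/-- **`μ_T(z,1) ≤ μ_{T+1}(y,z)`**: the top wall alone (by the symmetry `μ_{T+1}(y,z) = μ_{T+1}(z,y)`).
[cite: BeatonBousquetMelouDeGierDuminilCopinGuttmann2014, Proposition 6 (arXiv v5 p. 10: "μ_T(y,z) = μ_T(z,y)")] -/
theorem stripMuY₀_le_stripMuY₂_succ' (T : ℕ) (hy : 0 < y) (hz : 0 < z) : stripMuY₀ T z ≤ stripMuY₂ (T + 1) y z := by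
  rw [stripMuY₂_symm]
  exact stripMuY₀_le_stripMuY₂_succ T hz hy

/-- `max(μ_T(y,1), μ_T(z,1)) ≤ μ_{T+1}(y,z)`. [cite: BeatonBousquetMelouDeGierDuminilCopinGuttmann2014, Proposition 6 (arXiv v5 p. 10)] -/
theorem max_stripMuY₀_le_stripMuY₂_succ (T : ℕ) (hy : 0 < y) (hz : 0 < z) :
    max (stripMuY₀ T y) (stripMuY₀ T z) ≤ stripMuY₂ (T + 1) y z :=
  max_le (stripMuY₀_le_stripMuY₂_succ T hy hz) (stripMuY₀_le_stripMuY₂_succ' T hy hz)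

/-! ### §2 Rooted partition functions and the first-visit cuts -/

/-- The bottom-surface vertex `(1, 0)` of the cross-section. [cite: BeatonBousquetMelouDeGierDuminilCopinGuttmann2014, §3.2 (arXiv v5 p. 10)] -/
def botRoot : Site 2 := ![1, 0]

/-- The top-surface vertex `(T mod 2, T)` of the cross-section. [cite: BeatonBousquetMelouDeGierDuminilCopinGuttmann2014, §3.2 (arXiv v5 p. 10)] -/
def topRoot (T : ℕ) : Site 2 := ![(T : ℤ) % 2, T]

/-- **`D^bot_n(y,z)`**: the two-surface partition function of the strip walks starting AT the bottom-surface vertex `(1,0)`.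
[cite: BeatonBousquetMelouDeGierDuminilCopinGuttmann2014, §3.2 (arXiv v5 p. 10: walks from a mid-edge just below the strip)] -/
def botZ₂ (T n : ℕ) (y z : ℝ) : ℝ :=
  ∑ p ∈ (stripPairs T n).filter (fun p => p.1 = botRoot), y ^ bottomVisits₀ p.1 p.2 n * z ^ topVisits₀ T p.1 p.2 n

/-- **`D^top_n(y,z)`**: the two-surface partition function of the strip walks starting at the top-surface vertex `(T mod 2, T)`.
[cite: BeatonBousquetMelouDeGierDuminilCopinGuttmann2014, §3.2 (arXiv v5 p. 10)] -/
def topZ₂ (T n : ℕ) (y z : ℝ) : ℝ :=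
  ∑ p ∈ (stripPairs T n).filter (fun p => p.1 = topRoot T), y ^ bottomVisits₀ p.1 p.2 n * z ^ topVisits₀ T p.1 p.2 n

/-- `0 ≤ D^bot_n`. [cite: BeatonBousquetMelouDeGierDuminilCopinGuttmann2014, §3.2 (arXiv v5 p. 10)] -/
theorem botZ₂_nonneg (T n : ℕ) (hy : 0 ≤ y) (hz : 0 ≤ z) : 0 ≤ botZ₂ T n y z :=
  Finset.sum_nonneg fun _ _ => mul_nonneg (pow_nonneg hy _) (pow_nonneg hz _)

/-- `0 ≤ D^top_n`. [cite: BeatonBousquetMelouDeGierDuminilCopinGuttmann2014, §3.2 (arXiv v5 p. 10)] -/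
theorem topZ₂_nonneg (T n : ℕ) (hy : 0 ≤ y) (hz : 0 ≤ z) : 0 ≤ topZ₂ T n y z :=
  Finset.sum_nonneg fun _ _ => mul_nonneg (pow_nonneg hy _) (pow_nonneg hz _)

/-- `D^top_n(y,z) ≤ C_{T,n}(y,z)`. [cite: BeatonBousquetMelouDeGierDuminilCopinGuttmann2014, §3.2 (arXiv v5 p. 10)] -/
theorem topZ₂_le_stripZ₂ (T n : ℕ) (hy : 0 ≤ y) (hz : 0 ≤ z) : topZ₂ T n y z ≤ stripZ₂ T n y z :=
  Finset.sum_le_sum_of_subset_of_nonneg (Finset.filter_subset _ _) fun _ _ _ =>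
    mul_nonneg (pow_nonneg hy _) (pow_nonneg hz _)

/-- The cross-section representative of a bottom-surface vertex is `botRoot`, of a top-surface vertex is `topRoot T`.
[cite: MadrasSlade1993, §8.2, eq. (8.2.1) (translation classes)] -/
theorem snorm_eq_root {v : Site 2} :
    (v 1 = 0 ∧ v 0 % 2 = 1 → snorm v = botRoot) ∧ (v 1 = (T : ℤ) ∧ (v 0 + T) % 2 = 0 → snorm v = topRoot T) := by
  refine ⟨fun h => ?_, fun h => ?_⟩
  · ext j; fin_cases j
    · simp [botRoot]; omega
    · simp [botRoot]; omega
  · ext j; fin_cases j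
    · simp [topRoot]; omega
    · simp [topRoot]; omega

/-- The reflection `flipPair` sends the bottom root to the top root. [cite: BeatonBousquetMelouDeGierDuminilCopinGuttmann2014, Proposition 6 (arXiv v5 p. 10: symmetry)] -/
theorem flipPair_botRoot (T : ℕ) (υ : ℕ → Site 2) : (flipPair T (botRoot, υ)).1 = topRoot T := by
  simp only [flipPair]
  refine (snorm_eq_root (T := T)).2 ⟨?_, ?_⟩
  · simp [botRoot]
  · simp [botRoot]; omega

/-- **`D^bot_n(y,z) ≤ D^top_n(z,y)`** by the reflection exchanging the two surfaces.
[cite: BeatonBousquetMelouDeGierDuminilCopinGuttmann2014, Proposition 6 (arXiv v5 p. 10: "By the symmetry of bridges, μ_T(y,z) = μ_T(z,y)")] -/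
theorem botZ₂_le_topZ₂_swap (T n : ℕ) (hy : 0 ≤ y) (hz : 0 ≤ z) : botZ₂ T n y z ≤ topZ₂ T n z y := by
  classical
  set F := (stripPairs T n).filter (fun p => p.1 = botRoot) with hF
  have hinj : Set.InjOn (flipPair T) ↑F := fun p hp q hq h =>
    flipPair_injOn T n (Finset.mem_filter.1 (Finset.mem_coe.1 hp)).1 (Finset.mem_filter.1 (Finset.mem_coe.1 hq)).1 h
  have himg : F.image (flipPair T) ⊆ (stripPairs T n).filter (fun p => p.1 = topRoot T) := by
    intro q hq
    obtain ⟨p, hp, rfl⟩ := Finset.mem_image.1 hq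
    obtain ⟨hps, hpa⟩ := Finset.mem_filter.1 hp
    refine Finset.mem_filter.2 ⟨flipPair_mem hps, ?_⟩
    obtain ⟨a, υ⟩ := p
    simp only at hpa
    subst hpa
    exact flipPair_botRoot T υ
  calc botZ₂ T n y z
      = ∑ p ∈ F, z ^ bottomVisits₀ (flipPair T p).1 (flipPair T p).2 n * y ^ topVisits₀ T (flipPair T p).1 (flipPair T p).2 n := by
        refine Finset.sum_congr rfl fun p _ => ?_
        rw [bottomVisits₀_flipPair, topVisits₀_flipPair, mul_comm]
    _ = ∑ q ∈ F.image (flipPair T), z ^ bottomVisits₀ q.1 q.2 n * y ^ topVisits₀ T q.1 q.2 n := by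
        rw [Finset.sum_image hinj]
    _ ≤ topZ₂ T n z y :=
        Finset.sum_le_sum_of_subset_of_nonneg himg fun _ _ _ => mul_nonneg (pow_nonneg hz _) (pow_nonneg hy _)

/-! ### The first top-surface time -/

/-- The top-surface test at time `m` of the placed walk `a + υ ·`. [cite: BeatonBousquetMelouDeGierDuminilCopinGuttmann2014, §3.2 (arXiv v5 p. 10: contacts with the top of the strip)] -/
def IsTopAt (T : ℕ) (a : Site 2) (υ : ℕ → Site 2) (m : ℕ) : Prop := (a + υ m) 1 = (T : ℤ) ∧ ((a + υ m) 0 + T) % 2 = 0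

/-- The top-surface test is decidable. [cite: BeatonBousquetMelouDeGierDuminilCopinGuttmann2014, §3.2 (arXiv v5 p. 10); lane bookkeeping] -/
instance instDecidablePredIsTopAt (T : ℕ) (a : Site 2) (υ : ℕ → Site 2) : DecidablePred (IsTopAt T a υ) :=
  fun m => inferInstanceAs (Decidable ((a + υ m) 1 = (T : ℤ) ∧ ((a + υ m) 0 + T) % 2 = 0))

/-- `topVisits₀` counts the top-surface times (by definition). [cite: BeatonBousquetMelouDeGierDuminilCopinGuttmann2014, §3.2 (arXiv v5 p. 10); lane bookkeeping] -/
theorem topVisits₀_eq_sum_isTopAt (T : ℕ) (a : Site 2) (υ : ℕ → Site 2) (n : ℕ) :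
    topVisits₀ T a υ n = ∑ m ∈ range (n + 1), if IsTopAt T a υ m then 1 else 0 := rfl

open Classical in
/-- The FIRST top-surface time of the placed walk (`n + 1` if there is none).
[cite: HammersleyTorrieWhittington1982, §2 (decomposition at the first surface visit)] -/
def firstTop (T : ℕ) (a : Site 2) (υ : ℕ → Site 2) (n : ℕ) : ℕ :=
  if h : ∃ m, m ≤ n ∧ IsTopAt T a υ m then Nat.find h else n + 1

/-- `firstTop ≤ n + 1`. [cite: HammersleyTorrieWhittington1982, §2; lane bookkeeping] -/
theorem firstTop_le (T : ℕ) (a : Site 2) (υ : ℕ → Site 2) (n : ℕ) : firstTop T a υ n ≤ n + 1 := by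
  unfold firstTop
  split_ifs with h
  · exact (Nat.find_spec h).1.trans (Nat.le_succ n)
  · exact le_rfl

/-- If `firstTop = k ≤ n`, time `k` is a top-surface time and no earlier time is. [cite: HammersleyTorrieWhittington1982, §2; lane bookkeeping] -/
theorem firstTop_spec {a : Site 2} {υ : ℕ → Site 2} {n k : ℕ} (hk : firstTop T a υ n = k) (hkn : k ≤ n) :
    IsTopAt T a υ k ∧ ∀ m < k, ¬ IsTopAt T a υ m := by
  unfold firstTop at hk
  split_ifs at hk with h
  · subst hk
    exact ⟨(Nat.find_spec h).2, fun m hm hL => Nat.find_min h hm ⟨(le_of_lt hm).trans (Nat.find_spec h).1, hL⟩⟩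
  · omega

/-- If `firstTop = n + 1`, there is no top-surface time `≤ n`. [cite: HammersleyTorrieWhittington1982, §2; lane bookkeeping] -/
theorem firstTop_eq_succ {a : Site 2} {υ : ℕ → Site 2} {n : ℕ} (hk : firstTop T a υ n = n + 1) :
    ∀ m ≤ n, ¬ IsTopAt T a υ m := by
  unfold firstTop at hk
  split_ifs at hk with h
  · have := (Nat.find_spec h).1; omega
  · intro m hm hL; exact h ⟨m, hm, hL⟩

/-! ### The cut at the first top-surface visit -/

/-- A product-sum bound: a nonnegative function summed over a subset of a product is at most the product of the full sums.
[cite: MadrasSlade1993, §1.2, Lemma 1.2.2 (sub/supermultiplicativity bookkeeping)] -/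
private theorem sum_le_mul_sum_of_subset_product {S : Finset ((Site 2 × (ℕ → Site 2)) × (Site 2 × (ℕ → Site 2)))}
    {Q R : Finset (Site 2 × (ℕ → Site 2))} (hS : S ⊆ Q ×ˢ R) (f g : Site 2 × (ℕ → Site 2) → ℝ)
    (hf : ∀ q ∈ Q, 0 ≤ f q) (hg : ∀ r ∈ R, 0 ≤ g r) :
    ∑ x ∈ S, f x.1 * g x.2 ≤ (∑ q ∈ Q, f q) * ∑ r ∈ R, g r := by
  rw [Finset.sum_mul_sum, ← Finset.sum_product']
  exact Finset.sum_le_sum_of_subset_of_nonneg hS fun x hx _ =>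
    mul_nonneg (hf _ (Finset.mem_product.1 hx).1) (hg _ (Finset.mem_product.1 hx).2)

/-- The fibre of the first-top cut: over the walks of length `N + M` whose first top-surface time is `N`, the weight
factorises EXACTLY through `HexBW.split` into `y^{bc(prefix)}` times the two-surface weight of a suffix rooted at
`topRoot T`; hence the fibre sum is at most `C_{T,N}(y,1) · D^top_M(y,z)` (`T ≥ 1`).
[cite: HammersleyTorrieWhittington1982, §2 (first-surface-visit decomposition); MadrasSlade1993, §8.2, eq. (8.2.2) (p. 268: the splitting map)] -/
theorem sum_fibre_firstTop_le (hT : 1 ≤ T) (N M : ℕ) (hy : 0 ≤ y) (hz : 0 ≤ z) :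
    ∑ p ∈ (stripPairs T (N + M)).filter (fun p => firstTop T p.1 p.2 (N + M) = N),
        y ^ bottomVisits₀ p.1 p.2 (N + M) * z ^ topVisits₀ T p.1 p.2 (N + M) ≤
      stripZ₀ T N y * topZ₂ T M y z := by
  classical
  set F := (stripPairs T (N + M)).filter (fun p => firstTop T p.1 p.2 (N + M) = N) with hF
  -- exact weight bookkeeping through `split`
  have hw : ∀ p ∈ F, y ^ bottomVisits₀ p.1 p.2 (N + M) * z ^ topVisits₀ T p.1 p.2 (N + M) =
      y ^ bottomVisits₀ (split N M p).1.1 (split N M p).1.2 N *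
        (y ^ bottomVisits₀ (split N M p).2.1 (split N M p).2.2 M * z ^ topVisits₀ T (split N M p).2.1 (split N M p).2.2 M) := by
    intro p hp
    obtain ⟨hps, hk⟩ := Finset.mem_filter.1 hp
    obtain ⟨a, υ⟩ := p
    dsimp only at hk ⊢
    obtain ⟨htop, hmin⟩ := firstTop_spec hk (Nat.le_add_right N M)
    have htop' : (a + υ N) 1 = (T : ℤ) ∧ ((a + υ N) 0 + T) % 2 = 0 := htop
    have hb := bottomVisits₀_split a υ N M
    have ht := topVisits₀_split T a υ N M
    rw [if_neg (by omega)] at hb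
    rw [if_pos htop'] at ht
    -- the prefix meets the top surface exactly once, at its last time
    have htq : topVisits₀ T (split N M (a, υ)).1.1 (split N M (a, υ)).1.2 N = 1 := by
      rw [topVisits₀_eq_sum_isTopAt, Finset.sum_range_succ, Finset.sum_eq_zero fun m hm => ?_, zero_add, if_pos]
      · simpa [split, IsTopAt] using htop
      · have hm' : m < N := Finset.mem_range.1 hm
        rw [if_neg]
        simpa [split, IsTopAt, min_eq_left hm'.le] using hmin m hm'
    have e1 : bottomVisits₀ a υ (N + M) = bottomVisits₀ (split N M (a, υ)).1.1 (split N M (a, υ)).1.2 N +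
        bottomVisits₀ (split N M (a, υ)).2.1 (split N M (a, υ)).2.2 M := by omega
    have e2 : topVisits₀ T a υ (N + M) = topVisits₀ T (split N M (a, υ)).2.1 (split N M (a, υ)).2.2 M := by omega
    rw [e1, e2, pow_add]
    ring
  -- the image of the fibre under `split`
  have himg : F.image (split N M) ⊆ stripPairs T N ×ˢ (stripPairs T M).filter (fun r => r.1 = topRoot T) := by
    intro x hx
    obtain ⟨p, hp, rfl⟩ := Finset.mem_image.1 hx
    obtain ⟨hps, hk⟩ := Finset.mem_filter.1 hp
    have hm := Finset.mem_product.1 (split_mem hps)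
    refine Finset.mem_product.2 ⟨hm.1, Finset.mem_filter.2 ⟨hm.2, ?_⟩⟩
    obtain ⟨htop, -⟩ := firstTop_spec hk (Nat.le_add_right N M)
    exact (snorm_eq_root (T := T)).2 htop
  have hinj : Set.InjOn (split N M) ↑F := fun p hp q hq h =>
    split_injOn T N M (Finset.mem_filter.1 (Finset.mem_coe.1 hp)).1 (Finset.mem_filter.1 (Finset.mem_coe.1 hq)).1 h
  calc ∑ p ∈ F, y ^ bottomVisits₀ p.1 p.2 (N + M) * z ^ topVisits₀ T p.1 p.2 (N + M)
      = ∑ p ∈ F, y ^ bottomVisits₀ (split N M p).1.1 (split N M p).1.2 N *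
          (y ^ bottomVisits₀ (split N M p).2.1 (split N M p).2.2 M *
            z ^ topVisits₀ T (split N M p).2.1 (split N M p).2.2 M) := Finset.sum_congr rfl hw
    _ = ∑ x ∈ F.image (split N M), y ^ bottomVisits₀ x.1.1 x.1.2 N *
          (y ^ bottomVisits₀ x.2.1 x.2.2 M * z ^ topVisits₀ T x.2.1 x.2.2 M) := by
        rw [Finset.sum_image hinj]
    _ ≤ (∑ q ∈ stripPairs T N, y ^ bottomVisits₀ q.1 q.2 N) *
          ∑ r ∈ (stripPairs T M).filter (fun r => r.1 = topRoot T),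
            y ^ bottomVisits₀ r.1 r.2 M * z ^ topVisits₀ T r.1 r.2 M :=
        sum_le_mul_sum_of_subset_product himg (fun q => y ^ bottomVisits₀ q.1 q.2 N)
          (fun r => y ^ bottomVisits₀ r.1 r.2 M * z ^ topVisits₀ T r.1 r.2 M)
          (fun _ _ => pow_nonneg hy _) (fun _ _ => mul_nonneg (pow_nonneg hy _) (pow_nonneg hz _))
    _ = stripZ₀ T N y * topZ₂ T M y z := rfl

/-- **The cut at the first top-surface visit**: for `T ≥ 1`, `y, z ≥ 0`,
`C_{T,n}(y,z) ≤ C_{T,n}(y,1) + Σ_{m ≤ n} C_{T,m}(y,1) · D^top_{n−m}(y,z)`.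
[cite: HammersleyTorrieWhittington1982, §2 (first-surface-visit decomposition); BeatonBousquetMelouDeGierDuminilCopinGuttmann2014, Proposition 7 (arXiv v5 p. 11: proof by reference to [16] §§5–6)] -/
theorem stripZ₂_le_cut_top (hT : 1 ≤ T) (n : ℕ) (hy : 0 ≤ y) (hz : 0 ≤ z) :
    stripZ₂ T n y z ≤ stripZ₀ T n y + ∑ m ∈ range (n + 1), stripZ₀ T m y * topZ₂ T (n - m) y z := by
  classical
  have hmaps : ∀ p ∈ stripPairs T n, firstTop T p.1 p.2 n ∈ range (n + 2) := fun p _ =>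
    Finset.mem_range.2 (by have := firstTop_le T p.1 p.2 n; omega)
  rw [stripZ₂, ← Finset.sum_fiberwise_of_maps_to hmaps, Finset.sum_range_succ, add_comm]
  refine add_le_add ?_ (Finset.sum_le_sum fun k hk => ?_)
  · -- no top-surface visit: the weight is `y^{bc}`
    calc ∑ p ∈ (stripPairs T n).filter (fun p => firstTop T p.1 p.2 n = n + 1),
          y ^ bottomVisits₀ p.1 p.2 n * z ^ topVisits₀ T p.1 p.2 n
        = ∑ p ∈ (stripPairs T n).filter (fun p => firstTop T p.1 p.2 n = n + 1), y ^ bottomVisits₀ p.1 p.2 n :=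
          Finset.sum_congr rfl fun p hp => by
            obtain ⟨-, hk⟩ := Finset.mem_filter.1 hp
            have hz0 : topVisits₀ T p.1 p.2 n = 0 := Finset.sum_eq_zero fun m hm =>
              if_neg (firstTop_eq_succ hk m (by have := Finset.mem_range.1 hm; omega))
            rw [hz0, pow_zero, mul_one]
      _ ≤ stripZ₀ T n y := Finset.sum_le_sum_of_subset_of_nonneg (Finset.filter_subset _ _) fun _ _ _ => pow_nonneg hy _
  · have hkn : k ≤ n := by have := Finset.mem_range.1 hk; omega
    obtain ⟨M, rfl⟩ := Nat.exists_eq_add_of_le hkn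
    rw [Nat.add_sub_cancel_left]
    exact sum_fibre_firstTop_le hT k M hy hz

/-! ### The cut at the first bottom-surface visit of a walk rooted at the top -/

/-- A walk rooted at the top surface needs at least `T` steps to reach the bottom row.
[cite: MadrasSlade1993, §1.1 (a nearest-neighbour step changes one coordinate by one)] -/
theorem le_of_isL0_of_topRoot {υ : ℕ → Site 2} {m k : ℕ} (hυ : υ ∈ Zd.saws 2 m) (hkm : k ≤ m)
    (hk : IsL0 (topRoot T) υ k) : T ≤ k := by
  obtain ⟨h0, -, hadj, -⟩ := Zd.mem_saws.1 hυ
  have h1 := abs_le.1 (Zd.abs_apply_le_of_adj h0 hadj k hkm 1)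
  have h2 : (topRoot T + υ k) 1 = 0 := hk.1
  simp only [Pi.add_apply, topRoot] at h2
  simp at h2
  omega

/-- The fibre of the first-bottom cut for walks rooted at the top: exact factorisation through `split` into `z^{tc(prefix)}`
times the two-surface weight of a suffix rooted at `botRoot`; the fibre sum is at most `C_{T,N}(z,1) · D^bot_M(y,z)`.
[cite: HammersleyTorrieWhittington1982, §2; MadrasSlade1993, §8.2, eq. (8.2.2) (p. 268)] -/
theorem sum_fibre_firstL0_top_le (hT : 1 ≤ T) (N M : ℕ) (hy : 0 ≤ y) (hz : 0 ≤ z) :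
    ∑ p ∈ ((stripPairs T (N + M)).filter (fun p => p.1 = topRoot T)).filter
        (fun p => firstL0 p.1 p.2 (N + M) = N),
        y ^ bottomVisits₀ p.1 p.2 (N + M) * z ^ topVisits₀ T p.1 p.2 (N + M) ≤
      stripZ₀ T N z * botZ₂ T M y z := by
  classical
  set F := ((stripPairs T (N + M)).filter (fun p => p.1 = topRoot T)).filter
    (fun p => firstL0 p.1 p.2 (N + M) = N) with hF
  have hw : ∀ p ∈ F, y ^ bottomVisits₀ p.1 p.2 (N + M) * z ^ topVisits₀ T p.1 p.2 (N + M) =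
      z ^ topVisits₀ T (split N M p).1.1 (split N M p).1.2 N *
        (y ^ bottomVisits₀ (split N M p).2.1 (split N M p).2.2 M * z ^ topVisits₀ T (split N M p).2.1 (split N M p).2.2 M) := by
    intro p hp
    obtain ⟨hp1, hk⟩ := Finset.mem_filter.1 hp
    obtain ⟨hps, -⟩ := Finset.mem_filter.1 hp1
    obtain ⟨a, υ⟩ := p
    dsimp only at hk ⊢
    obtain ⟨hbot, hmin⟩ := firstL0_spec hk (Nat.le_add_right N M)
    have hbot' : (a + υ N) 1 = 0 ∧ (a + υ N) 0 % 2 = 1 := hbot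
    have hb := bottomVisits₀_split a υ N M
    have ht := topVisits₀_split T a υ N M
    rw [if_pos hbot'] at hb
    rw [if_neg (by omega)] at ht
    -- the prefix meets the bottom surface exactly once, at its last time
    have hbq : bottomVisits₀ (split N M (a, υ)).1.1 (split N M (a, υ)).1.2 N = 1 := by
      rw [bottomVisits₀_eq_sum_isL0, Finset.sum_range_succ, Finset.sum_eq_zero fun m hm => ?_, zero_add, if_pos]
      · simpa [split, IsL0] using hbot
      · have hm' : m < N := Finset.mem_range.1 hm
        rw [if_neg]
        simpa [split, IsL0, min_eq_left hm'.le] using hmin m hm'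
    have e1 : bottomVisits₀ a υ (N + M) = bottomVisits₀ (split N M (a, υ)).2.1 (split N M (a, υ)).2.2 M := by omega
    have e2 : topVisits₀ T a υ (N + M) = topVisits₀ T (split N M (a, υ)).1.1 (split N M (a, υ)).1.2 N +
        topVisits₀ T (split N M (a, υ)).2.1 (split N M (a, υ)).2.2 M := by omega
    rw [e1, e2, pow_add]
    ring
  have himg : F.image (split N M) ⊆ stripPairs T N ×ˢ (stripPairs T M).filter (fun r => r.1 = botRoot) := by
    intro x hx
    obtain ⟨p, hp, rfl⟩ := Finset.mem_image.1 hx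
    obtain ⟨hp1, hk⟩ := Finset.mem_filter.1 hp
    obtain ⟨hps, -⟩ := Finset.mem_filter.1 hp1
    have hm := Finset.mem_product.1 (split_mem hps)
    refine Finset.mem_product.2 ⟨hm.1, Finset.mem_filter.2 ⟨hm.2, ?_⟩⟩
    obtain ⟨hbot, -⟩ := firstL0_spec hk (Nat.le_add_right N M)
    exact (snorm_eq_root (T := T)).1 hbot
  have hinj : Set.InjOn (split N M) ↑F := fun p hp q hq h =>
    split_injOn T N M (Finset.mem_filter.1 (Finset.mem_filter.1 (Finset.mem_coe.1 hp)).1).1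
      (Finset.mem_filter.1 (Finset.mem_filter.1 (Finset.mem_coe.1 hq)).1).1 h
  calc ∑ p ∈ F, y ^ bottomVisits₀ p.1 p.2 (N + M) * z ^ topVisits₀ T p.1 p.2 (N + M)
      = ∑ p ∈ F, z ^ topVisits₀ T (split N M p).1.1 (split N M p).1.2 N *
          (y ^ bottomVisits₀ (split N M p).2.1 (split N M p).2.2 M *
            z ^ topVisits₀ T (split N M p).2.1 (split N M p).2.2 M) := Finset.sum_congr rfl hw
    _ = ∑ x ∈ F.image (split N M), z ^ topVisits₀ T x.1.1 x.1.2 N *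
          (y ^ bottomVisits₀ x.2.1 x.2.2 M * z ^ topVisits₀ T x.2.1 x.2.2 M) := by
        rw [Finset.sum_image hinj]
    _ ≤ (∑ q ∈ stripPairs T N, z ^ topVisits₀ T q.1 q.2 N) *
          ∑ r ∈ (stripPairs T M).filter (fun r => r.1 = botRoot),
            y ^ bottomVisits₀ r.1 r.2 M * z ^ topVisits₀ T r.1 r.2 M :=
        sum_le_mul_sum_of_subset_product himg (fun q => z ^ topVisits₀ T q.1 q.2 N)
          (fun r => y ^ bottomVisits₀ r.1 r.2 M * z ^ topVisits₀ T r.1 r.2 M)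
          (fun _ _ => pow_nonneg hz _) (fun _ _ => mul_nonneg (pow_nonneg hy _) (pow_nonneg hz _))
    _ = stripZtop T N z * botZ₂ T M y z := rfl
    _ = stripZ₀ T N z * botZ₂ T M y z := by rw [stripZtop_eq_stripZ₀]

/-- **The cut at the first bottom-surface visit, for walks rooted at the top**: for `T ≥ 1`, `y, z ≥ 0`,
`D^top_n(y,z) ≤ C_{T,n}(z,1) + Σ_{T ≤ m ≤ n} C_{T,m}(z,1) · D^top_{n−m}(z,y)` (sum over `m ∈ Ico T (n+1)`; a walk rooted at the top needs at least `T`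
steps before its first bottom-surface visit; the suffix rooted at the bottom is reflected to a top-rooted one).
[cite: HammersleyTorrieWhittington1982, §2; BeatonBousquetMelouDeGierDuminilCopinGuttmann2014, Proposition 6 (arXiv v5 p. 10: symmetry) and Proposition 7 (p. 11)] -/
theorem topZ₂_le_cut_bot (hT : 1 ≤ T) (n : ℕ) (hy : 0 ≤ y) (hz : 0 ≤ z) :
    topZ₂ T n y z ≤ stripZ₀ T n z + ∑ m ∈ Finset.Ico T (n + 1), stripZ₀ T m z * topZ₂ T (n - m) z y := by
  classical
  set G := (stripPairs T n).filter (fun p => p.1 = topRoot T) with hG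
  have hmaps : ∀ p ∈ G, firstL0 p.1 p.2 n ∈ range (n + 2) := fun p _ =>
    Finset.mem_range.2 (by have := firstL0_le p.1 p.2 n; omega)
  rw [topZ₂, ← hG, ← Finset.sum_fiberwise_of_maps_to hmaps, Finset.sum_range_succ, add_comm]
  refine add_le_add ?_ ?_
  · -- no bottom-surface visit: the weight is `z^{tc}`
    calc ∑ p ∈ G.filter (fun p => firstL0 p.1 p.2 n = n + 1), y ^ bottomVisits₀ p.1 p.2 n * z ^ topVisits₀ T p.1 p.2 n
        = ∑ p ∈ G.filter (fun p => firstL0 p.1 p.2 n = n + 1), z ^ topVisits₀ T p.1 p.2 n :=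
          Finset.sum_congr rfl fun p hp => by
            obtain ⟨-, hk⟩ := Finset.mem_filter.1 hp
            have hb0 : bottomVisits₀ p.1 p.2 n = 0 := Finset.sum_eq_zero fun m hm =>
              if_neg (firstL0_eq_succ hk m (by have := Finset.mem_range.1 hm; omega))
            rw [hb0, pow_zero, one_mul]
      _ ≤ stripZtop T n z := Finset.sum_le_sum_of_subset_of_nonneg
          ((Finset.filter_subset _ _).trans (Finset.filter_subset _ _)) fun _ _ _ => pow_nonneg hz _
      _ = stripZ₀ T n z := stripZtop_eq_stripZ₀ T n z
  · -- fibres `k ≤ n`: empty for `k < T`, bounded by the product for `k ≥ T`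
    have hfib : ∀ k ∈ range (n + 1),
        ∑ p ∈ G.filter (fun p => firstL0 p.1 p.2 n = k), y ^ bottomVisits₀ p.1 p.2 n * z ^ topVisits₀ T p.1 p.2 n ≤
          if T ≤ k then stripZ₀ T k z * topZ₂ T (n - k) z y else 0 := by
      intro k hk
      have hkn : k ≤ n := by have := Finset.mem_range.1 hk; omega
      split_ifs with hTk
      · obtain ⟨M, rfl⟩ := Nat.exists_eq_add_of_le hkn
        rw [Nat.add_sub_cancel_left]
        refine (sum_fibre_firstL0_top_le hT k M hy hz).trans ?_
        exact mul_le_mul_of_nonneg_left (botZ₂_le_topZ₂_swap T M hy hz)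
          (by unfold stripZ₀; exact Finset.sum_nonneg fun _ _ => pow_nonneg hz _)
      · -- the fibre is empty
        have hempty : G.filter (fun p => firstL0 p.1 p.2 n = k) = ∅ := by
          refine Finset.filter_eq_empty_iff.2 fun p hp hk' => hTk ?_
          obtain ⟨hps, hpa⟩ := Finset.mem_filter.1 hp
          obtain ⟨-, hυ, -, -⟩ := mem_stripPairs.1 hps
          obtain ⟨hbot, -⟩ := firstL0_spec hk' hkn
          rw [hpa] at hbot
          exact le_of_isL0_of_topRoot hυ hkn hbot
        rw [hempty, Finset.sum_empty]
    refine (Finset.sum_le_sum hfib).trans (le_of_eq ?_)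
    rw [← Finset.sum_filter]
    refine Finset.sum_congr ?_ fun _ _ => rfl
    ext k
    simp only [Finset.mem_filter, Finset.mem_range, Finset.mem_Ico]
    omega

/-! ### §3 The renewal induction -/

/-- Absorbing the sub-exponential factor: for `θ > 1` there is `K_θ ≥ 1` with `e^{22√m} ≤ K_θ θᵐ` for every `m`.
[cite: MadrasSlade1993, §1.2 (subexponential corrections do not change growth rates)] -/
theorem exists_exp_sqrt_le_mul_pow {θ : ℝ} (hθ : 1 < θ) : ∃ K : ℝ, 1 ≤ K ∧ ∀ m : ℕ, Real.exp (22 * Real.sqrt m) ≤ K * θ ^ m := by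
  obtain ⟨N, hN⟩ := (eventually_exp_sqrt_le_pow hθ 22).exists_forall_of_atTop
  refine ⟨Real.exp (22 * Real.sqrt N), Real.one_le_exp (by positivity), fun m => ?_⟩
  rcases le_or_gt N m with h | h
  · calc Real.exp (22 * Real.sqrt m) ≤ θ ^ m := hN m h
      _ = 1 * θ ^ m := (one_mul _).symm
      _ ≤ Real.exp (22 * Real.sqrt N) * θ ^ m :=
          mul_le_mul_of_nonneg_right (Real.one_le_exp (by positivity)) (pow_nonneg (zero_le_one.trans hθ.le) _)
  · have h1 : Real.exp (22 * Real.sqrt m) ≤ Real.exp (22 * Real.sqrt N) :=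
      Real.exp_le_exp.2 (mul_le_mul_of_nonneg_left (Real.sqrt_le_sqrt (by exact_mod_cast h.le)) (by norm_num))
    have h2 : (1 : ℝ) ≤ θ ^ m := one_le_pow₀ hθ.le
    calc Real.exp (22 * Real.sqrt m) ≤ Real.exp (22 * Real.sqrt N) * 1 := by rw [mul_one]; exact h1
      _ ≤ Real.exp (22 * Real.sqrt N) * θ ^ m := mul_le_mul_of_nonneg_left h2 (Real.exp_nonneg _)

/-- **The renewal induction.**  Let `T ≥ 1`, `y, z > 0`, `θ, Λ > 1`, `M := max(μ(y), μ(z))`, `ρ := θ Λ M`, and let `K₁`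
dominate the one-wall pieces, `C_{T,m}(y,1), C_{T,m}(z,1) ≤ K₁ (θM)ᵐ` for all `m`.  If `K₁ Λ^{−T}/(1 − Λ^{−1}) ≤ 1/2` then
`D^top_n(y,z), D^top_n(z,y) ≤ 2K₁ ρⁿ` for every `n` (strong induction on `n` through the first-bottom cut, whose pieces have
length `≥ T`). [cite: HammersleyTorrieWhittington1982, §2 (decomposition at surface visits); BeatonBousquetMelouDeGierDuminilCopinGuttmann2014, Proposition 7 (arXiv v5 p. 11: proof by reference to [16] §§5–6)] -/
theorem topZ₂_le_of_renewal (hT : 1 ≤ T) (hy : 0 < y) (hz : 0 < z) {θ Λ K₁ : ℝ} (hθ : 1 ≤ θ) (hΛ : 1 < Λ) (hK₁ : 0 ≤ K₁)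
    (hPy : ∀ m : ℕ, stripZ₀ T m y ≤ K₁ * (θ * max (HV.surfaceMu y) (HV.surfaceMu z)) ^ m)
    (hPz : ∀ m : ℕ, stripZ₀ T m z ≤ K₁ * (θ * max (HV.surfaceMu y) (HV.surfaceMu z)) ^ m)
    (hsmall : K₁ * ((Λ⁻¹) ^ T / (1 - Λ⁻¹)) ≤ 1 / 2) (n : ℕ) :
    max (topZ₂ T n y z) (topZ₂ T n z y) ≤ 2 * K₁ * (θ * Λ * max (HV.surfaceMu y) (HV.surfaceMu z)) ^ n := by
  set M := max (HV.surfaceMu y) (HV.surfaceMu z) with hM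
  have hM0 : 0 < M := lt_max_of_lt_left (HV.surfaceMu_pos y)
  set ρ := θ * Λ * M with hρ
  have hΛ0 : 0 < Λ := zero_lt_one.trans hΛ
  have hr0 : 0 ≤ Λ⁻¹ := inv_nonneg.2 hΛ0.le
  have hr1 : Λ⁻¹ < 1 := inv_lt_one_of_one_lt₀ hΛ
  have hθM : 0 < θ * M := mul_pos (zero_lt_one.trans_le hθ) hM0
  have hρ0 : 0 < ρ := by rw [hρ]; positivity
  -- `(θM)^m = ρ^m Λ^{-m}`
  have hsplit : ∀ m : ℕ, (θ * M) ^ m = ρ ^ m * (Λ⁻¹) ^ m := fun m => by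
    rw [hρ, ← mul_pow]; congr 1; field_simp
  induction n using Nat.strong_induction_on with
  | _ n ih =>
    -- both orderings obey the same recursion
    have step : ∀ {u v : ℝ}, 0 < u → 0 < v → max (HV.surfaceMu u) (HV.surfaceMu v) = M →
        (∀ m : ℕ, stripZ₀ T m v ≤ K₁ * (θ * M) ^ m) →
        (∀ k < n, topZ₂ T k v u ≤ 2 * K₁ * ρ ^ k) → topZ₂ T n u v ≤ 2 * K₁ * ρ ^ n := by
      intro u v hu hv _ hPv ihk
      have hcut := topZ₂_le_cut_bot (y := u) (z := v) hT n hu.le hv.le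
      have hsum : ∑ m ∈ Finset.Ico T (n + 1), stripZ₀ T m v * topZ₂ T (n - m) v u ≤
          ∑ m ∈ Finset.Ico T (n + 1), K₁ * (θ * M) ^ m * (2 * K₁ * ρ ^ (n - m)) := by
        refine Finset.sum_le_sum fun m hm => ?_
        have hm' := Finset.mem_Ico.1 hm
        exact mul_le_mul (hPv m) (ihk (n - m) (by omega)) (topZ₂_nonneg T _ hv.le hu.le)
          (mul_nonneg hK₁ (pow_nonneg hθM.le _))
      have hgeom : ∑ m ∈ Finset.Ico T (n + 1), K₁ * (θ * M) ^ m * (2 * K₁ * ρ ^ (n - m)) =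
          2 * K₁ * ρ ^ n * (K₁ * ∑ m ∈ Finset.Ico T (n + 1), (Λ⁻¹) ^ m) := by
        rw [Finset.mul_sum, Finset.mul_sum]
        refine Finset.sum_congr rfl fun m hm => ?_
        have hm' := Finset.mem_Ico.1 hm
        rw [hsplit m, show ρ ^ n = ρ ^ m * ρ ^ (n - m) by rw [← pow_add]; congr 1; omega]
        ring
      have htail : K₁ * ∑ m ∈ Finset.Ico T (n + 1), (Λ⁻¹) ^ m ≤ 1 / 2 :=
        (mul_le_mul_of_nonneg_left (geom_sum_Ico_le_of_lt_one hr0 hr1) hK₁).trans hsmall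
      have h2K : 0 ≤ 2 * K₁ * ρ ^ n := by positivity
      have hmain : topZ₂ T n u v ≤ K₁ * ρ ^ n + 2 * K₁ * ρ ^ n * (1 / 2) := by
        refine hcut.trans (add_le_add ?_ ?_)
        · refine (hPv n).trans (mul_le_mul_of_nonneg_left ?_ hK₁)
          rw [hsplit n]
          exact mul_le_of_le_one_right (pow_nonneg hρ0.le _) (pow_le_one₀ hr0 hr1.le)
        · calc ∑ m ∈ Finset.Ico T (n + 1), stripZ₀ T m v * topZ₂ T (n - m) v u
              ≤ ∑ m ∈ Finset.Ico T (n + 1), K₁ * (θ * M) ^ m * (2 * K₁ * ρ ^ (n - m)) := hsum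
            _ = 2 * K₁ * ρ ^ n * (K₁ * ∑ m ∈ Finset.Ico T (n + 1), (Λ⁻¹) ^ m) := hgeom
            _ ≤ 2 * K₁ * ρ ^ n * (1 / 2) := mul_le_mul_of_nonneg_left htail h2K
      linarith [hmain, pow_nonneg hρ0.le n]
    refine max_le ?_ ?_
    · exact step hy hz rfl hPz fun k hk => (le_max_right _ _).trans (ih k hk)
    · refine step hz hy (by rw [hM, max_comm]) hPy fun k hk => (le_max_left _ _).trans (ih k hk)

/-- **Bound for all strip walks** under the hypotheses of the renewal induction:
`C_{T,n}(y,z) ≤ K₁ (1 + 2K₁/(1−Λ^{−1})) ρⁿ` (first-top cut + the rooted bound).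
[cite: HammersleyTorrieWhittington1982, §2; BeatonBousquetMelouDeGierDuminilCopinGuttmann2014, Proposition 7 (arXiv v5 p. 11)] -/
theorem stripZ₂_le_of_renewal (hT : 1 ≤ T) (hy : 0 < y) (hz : 0 < z) {θ Λ K₁ : ℝ} (hθ : 1 ≤ θ) (hΛ : 1 < Λ) (hK₁ : 0 ≤ K₁)
    (hPy : ∀ m : ℕ, stripZ₀ T m y ≤ K₁ * (θ * max (HV.surfaceMu y) (HV.surfaceMu z)) ^ m)
    (hPz : ∀ m : ℕ, stripZ₀ T m z ≤ K₁ * (θ * max (HV.surfaceMu y) (HV.surfaceMu z)) ^ m)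
    (hsmall : K₁ * ((Λ⁻¹) ^ T / (1 - Λ⁻¹)) ≤ 1 / 2) (n : ℕ) :
    stripZ₂ T n y z ≤ K₁ * (1 + 2 * K₁ / (1 - Λ⁻¹)) * (θ * Λ * max (HV.surfaceMu y) (HV.surfaceMu z)) ^ n := by
  set M := max (HV.surfaceMu y) (HV.surfaceMu z) with hM
  have hM0 : 0 < M := lt_max_of_lt_left (HV.surfaceMu_pos y)
  set ρ := θ * Λ * M with hρ
  have hΛ0 : 0 < Λ := zero_lt_one.trans hΛ
  have hr0 : 0 ≤ Λ⁻¹ := inv_nonneg.2 hΛ0.le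
  have hr1 : Λ⁻¹ < 1 := inv_lt_one_of_one_lt₀ hΛ
  have hθM : 0 < θ * M := mul_pos (zero_lt_one.trans_le hθ) hM0
  have hρ0 : 0 < ρ := by rw [hρ]; positivity
  have hsplit : ∀ m : ℕ, (θ * M) ^ m = ρ ^ m * (Λ⁻¹) ^ m := fun m => by
    rw [hρ, ← mul_pow]; congr 1; field_simp
  have hE : ∀ k, topZ₂ T k y z ≤ 2 * K₁ * ρ ^ k := fun k =>
    (le_max_left _ _).trans (topZ₂_le_of_renewal hT hy hz hθ hΛ hK₁ hPy hPz hsmall k)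
  have hcut := stripZ₂_le_cut_top (y := y) (z := z) hT n hy.le hz.le
  have hsum : ∑ m ∈ range (n + 1), stripZ₀ T m y * topZ₂ T (n - m) y z ≤
      ∑ m ∈ range (n + 1), K₁ * (θ * M) ^ m * (2 * K₁ * ρ ^ (n - m)) := by
    refine Finset.sum_le_sum fun m hm => ?_
    exact mul_le_mul (hPy m) (hE (n - m)) (topZ₂_nonneg T _ hy.le hz.le) (mul_nonneg hK₁ (pow_nonneg hθM.le _))
  have hgeom : ∑ m ∈ range (n + 1), K₁ * (θ * M) ^ m * (2 * K₁ * ρ ^ (n - m)) =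
      2 * K₁ * ρ ^ n * (K₁ * ∑ m ∈ range (n + 1), (Λ⁻¹) ^ m) := by
    rw [Finset.mul_sum, Finset.mul_sum]
    refine Finset.sum_congr rfl fun m hm => ?_
    have hm' := Finset.mem_range.1 hm
    rw [hsplit m, show ρ ^ n = ρ ^ m * ρ ^ (n - m) by rw [← pow_add]; congr 1; omega]
    ring
  have htail : ∑ m ∈ range (n + 1), (Λ⁻¹) ^ m ≤ 1 / (1 - Λ⁻¹) := by
    have h := geom_sum_Ico_le_of_lt_one (m := 0) (n := n + 1) hr0 hr1
    rwa [pow_zero, ← Finset.range_eq_Ico] at h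
  calc stripZ₂ T n y z ≤ stripZ₀ T n y + ∑ m ∈ range (n + 1), stripZ₀ T m y * topZ₂ T (n - m) y z := hcut
    _ ≤ K₁ * ρ ^ n + 2 * K₁ * ρ ^ n * (K₁ * (1 / (1 - Λ⁻¹))) := by
        refine add_le_add ?_ (hsum.trans ?_)
        · refine (hPy n).trans (mul_le_mul_of_nonneg_left ?_ hK₁)
          rw [hsplit n]
          exact mul_le_of_le_one_right (pow_nonneg hρ0.le _) (pow_le_one₀ hr0 hr1.le)
        · rw [hgeom]
          exact mul_le_mul_of_nonneg_left (mul_le_mul_of_nonneg_left htail hK₁) (by positivity)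
    _ = K₁ * (1 + 2 * K₁ / (1 - Λ⁻¹)) * ρ ^ n := by ring

/-- From an exponential bound on every `C_{T,n}(y,z)` to a bound on the rate: `(∀ n, C_{T,n} ≤ K rⁿ) → μ_T(y,z) ≤ r`.
[cite: BeatonBousquetMelouDeGierDuminilCopinGuttmann2014, Proposition 6 (arXiv v5 p. 10: μ_T(y,z) = lim C_{T,n}(y,z)^{1/n})] -/
theorem stripMuY₂_le_of_stripZ₂_le (hy : 0 < y) (hz : 0 < z) {K r : ℝ} (hK : 0 < K) (hr : 0 < r)
    (h : ∀ n : ℕ, stripZ₂ T n y z ≤ K * r ^ n) : stripMuY₂ T y z ≤ r := by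
  have hlim := tendsto_stripZ₂_rpow T hy hz
  have hKlim : Tendsto (fun n : ℕ => K ^ (1 / (n : ℝ)) * r) atTop (𝓝 (1 * r)) := by
    refine Tendsto.mul_const r ?_
    have h1 : Tendsto (fun n : ℕ => Real.log K / (n : ℝ)) atTop (𝓝 0) := tendsto_const_div_atTop_nhds_zero_nat _
    have h2 := (Real.continuous_exp.tendsto _).comp h1
    rw [Real.exp_zero] at h2
    refine h2.congr fun n => ?_
    rw [Function.comp_apply, Real.rpow_def_of_pos hK, mul_one_div]
  rw [one_mul] at hKlim
  refine le_of_tendsto_of_tendsto hlim hKlim ?_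
  filter_upwards [eventually_ge_atTop 1] with n hn
  have hn0 : (n : ℝ) ≠ 0 := by exact_mod_cast (show n ≠ 0 by omega)
  calc stripZ₂ T n y z ^ (1 / (n : ℝ)) ≤ (K * r ^ n) ^ (1 / (n : ℝ)) :=
        Real.rpow_le_rpow (stripZ₂_pos T n hy hz).le (h n) (by positivity)
    _ = K ^ (1 / (n : ℝ)) * r := by
        rw [Real.mul_rpow hK.le (pow_nonneg hr.le _), ← Real.rpow_natCast r n, ← Real.rpow_mul hr.le,
          mul_one_div_cancel hn0, Real.rpow_one]

/-! ### §4 The two-wall limit -/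

/-- **Upper bound: for every `t > 1`, eventually in `T`, `μ_T(y,z) ≤ t · max(μ(y), μ(z))`** (`y, z > 0`).
[cite: BeatonBousquetMelouDeGierDuminilCopinGuttmann2014, Proposition 7 (arXiv v5 p. 11: μ_T(1,y) → μ(y); proof by reference to [16] §§5–6, where the two-wall slab statement is printed for ℤ^d)] -/
theorem eventually_stripMuY₂_le (hy : 0 < y) (hz : 0 < z) {t : ℝ} (ht : 1 < t) :
    ∀ᶠ T : ℕ in atTop, stripMuY₂ T y z ≤ t * max (HV.surfaceMu y) (HV.surfaceMu z) := by
  set M := max (HV.surfaceMu y) (HV.surfaceMu z) with hM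
  have hM0 : 0 < M := lt_max_of_lt_left (HV.surfaceMu_pos y)
  -- `θ = Λ = √t`
  set s := Real.sqrt t with hs
  have ht0 : 0 ≤ t := zero_le_one.trans ht.le
  have hs1 : 1 < s := by rw [hs, Real.lt_sqrt zero_le_one]; simpa using ht
  have hs0 : 0 < s := zero_lt_one.trans hs1
  have hss : s * s = t := Real.mul_self_sqrt ht0
  obtain ⟨Kθ, hKθ1, hKθ⟩ := exists_exp_sqrt_le_mul_pow hs1
  have hKθ0 : 0 < Kθ := zero_lt_one.trans_le hKθ1
  -- the one-wall piece constants, affine in `T`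
  set cy := hexConnectiveConstant ^ 2 * wallRate y ^ 2 with hcy
  set cz := hexConnectiveConstant ^ 2 * wallRate z ^ 2 with hcz
  have hμ0 : 0 < hexConnectiveConstant := hexConnectiveConstant_pos
  have hcy0 : 0 ≤ cy := by positivity
  have hcz0 : 0 ≤ cz := by positivity
  set K₁ : ℕ → ℝ := fun T => (2 * ((T : ℝ) + 1) * hexConnectiveConstant + (cy + cz)) * Kθ with hK₁
  have hK₁0 : ∀ T : ℕ, 0 ≤ K₁ T := fun T => by positivity
  have hy' : HV.surfaceMu y ≤ M := le_max_left _ _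
  have hz' : HV.surfaceMu z ≤ M := le_max_right _ _
  have hPw : ∀ (T m : ℕ) {w : ℝ}, 0 < w → HV.surfaceMu w ≤ M → hexConnectiveConstant ^ 2 * wallRate w ^ 2 ≤ cy + cz →
      stripZ₀ T m w ≤ K₁ T * (s * M) ^ m := by
    intro T m w hw hwM hcw
    have h1 := stripZ₀_le_explicit hw T m
    have h2 : (2 * ((T : ℝ) + 1) * hexConnectiveConstant + hexConnectiveConstant ^ 2 * wallRate w ^ 2) ≤
        2 * ((T : ℝ) + 1) * hexConnectiveConstant + (cy + cz) := by linarith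
    have h3 : HV.surfaceMu w ^ m ≤ M ^ m := pow_le_pow_left₀ (HV.surfaceMu_pos w).le hwM m
    calc stripZ₀ T m w
        ≤ (2 * ((T : ℝ) + 1) * hexConnectiveConstant + hexConnectiveConstant ^ 2 * wallRate w ^ 2) *
            Real.exp (22 * Real.sqrt m) * HV.surfaceMu w ^ m := h1
      _ ≤ (2 * ((T : ℝ) + 1) * hexConnectiveConstant + (cy + cz)) * (Kθ * s ^ m) * M ^ m :=
          mul_le_mul (mul_le_mul h2 (hKθ m) (Real.exp_nonneg _) (by positivity)) h3
            (pow_nonneg (HV.surfaceMu_pos w).le _) (by positivity)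
      _ = K₁ T * (s * M) ^ m := by rw [hK₁, mul_pow]; ring
  -- the smallness condition holds eventually in `T`
  have hr0 : 0 ≤ s⁻¹ := inv_nonneg.2 hs0.le
  have hr1 : s⁻¹ < 1 := inv_lt_one_of_one_lt₀ hs1
  have hsmall : ∀ᶠ T : ℕ in atTop, K₁ T * ((s⁻¹) ^ T / (1 - s⁻¹)) ≤ 1 / 2 := by
    have h1 : Tendsto (fun T : ℕ => (T : ℝ) * (s⁻¹) ^ T) atTop (𝓝 0) := tendsto_self_mul_const_pow_of_lt_one hr0 hr1
    have h2 : Tendsto (fun T : ℕ => (s⁻¹) ^ T) atTop (𝓝 0) := tendsto_pow_atTop_nhds_zero_of_lt_one hr0 hr1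
    have h3 : Tendsto (fun T : ℕ => K₁ T * ((s⁻¹) ^ T / (1 - s⁻¹))) atTop (𝓝 0) := by
      have h := ((h1.const_mul (2 * hexConnectiveConstant * Kθ / (1 - s⁻¹))).add
        (h2.const_mul ((2 * hexConnectiveConstant + (cy + cz)) * Kθ / (1 - s⁻¹))))
      rw [mul_zero, mul_zero, add_zero] at h
      refine h.congr fun T => ?_
      rw [hK₁]
      ring
    exact (h3.eventually (gt_mem_nhds (by norm_num : (0 : ℝ) < 1 / 2))).mono fun T hT => hT.le
  filter_upwards [hsmall, eventually_ge_atTop 1] with T hTs hT1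
  have hb := stripZ₂_le_of_renewal hT1 hy hz hs1.le hs1 (hK₁0 T)
    (fun m => hPw T m hy hy' (by rw [hcy]; linarith)) (fun m => hPw T m hz hz' (by rw [hcz]; linarith)) hTs
  have hK' : 0 < K₁ T * (1 + 2 * K₁ T / (1 - s⁻¹)) := by
    have : 0 < K₁ T := by rw [hK₁]; positivity
    have : 0 < 1 - s⁻¹ := by linarith
    positivity
  have h := stripMuY₂_le_of_stripZ₂_le hy hz hK' (mul_pos (mul_pos hs0 hs0) hM0) hb
  calc stripMuY₂ T y z ≤ s * s * M := h
    _ = t * M := by rw [hss]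

/-- ★ **The two-wall strip rate converges to the larger one-wall rate**: for `y, z > 0`,
`μ_T(y,z) → max(μ(y), μ(z))` as `T → ∞`, `μ(w) = HV.surfaceMu w = max(β(w), μ)` the one-wall half-plane surface rate.
Lower half: sub-strips (`S_T ⊂ S_{T+1}` misses the top surface) + `tendsto_stripMuY₀` + the symmetry; upper half: the renewal
induction over alternating first visits to the two surfaces.
[cite: BeatonBousquetMelouDeGierDuminilCopinGuttmann2014, Proposition 6 (arXiv v5 p. 10: μ_T(y,z), symmetry) and Proposition 7 (p. 11: "μ_T(1,y) → μ(y)", proof by reference to [16] = Janse van Rensburg–Orlandini–Whittington 2006, §§5–6, where the two-wall statement is proved for slabs of ℤ^d)] -/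
theorem tendsto_stripMuY₂_atTop (hy : 0 < y) (hz : 0 < z) :
    Tendsto (fun T : ℕ => stripMuY₂ T y z) atTop (𝓝 (max (HV.surfaceMu y) (HV.surfaceMu z))) := by
  set M := max (HV.surfaceMu y) (HV.surfaceMu z) with hM
  have hM0 : 0 < M := lt_max_of_lt_left (HV.surfaceMu_pos y)
  refine tendsto_order.2 ⟨fun a ha => ?_, fun a ha => ?_⟩
  · -- lower half, through the one-wall rates of `S_{T-1}`
    have hlow : Tendsto (fun T : ℕ => max (stripMuY₀ T y) (stripMuY₀ T z)) atTop (𝓝 M) :=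
      (tendsto_stripMuY₀ hy).max (tendsto_stripMuY₀ hz)
    obtain ⟨N, hN⟩ := (hlow.eventually (lt_mem_nhds ha)).exists_forall_of_atTop
    refine Filter.eventually_atTop.2 ⟨N + 1, fun T hT => ?_⟩
    obtain ⟨T', rfl⟩ : ∃ T', T = T' + 1 := ⟨T - 1, by omega⟩
    exact (hN T' (by omega)).trans_le (max_stripMuY₀_le_stripMuY₂_succ T' hy hz)
  · -- upper half
    set t := (a / M + 1) / 2 with htdef
    have haM : 1 < a / M := (one_lt_div hM0).2 ha
    have ht1 : 1 < t := by rw [htdef]; linarith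
    have htM : t * M < a := by
      rw [htdef]
      have : a / M * M = a := div_mul_cancel₀ a hM0.ne'
      nlinarith
    filter_upwards [eventually_stripMuY₂_le hy hz ht1] with T hT
    exact hT.trans_lt htM

/-- In the desorbed square `y, z ≤ 1 + √2`: `μ_T(y,z) → μ`. [cite: BeatonBousquetMelouDeGierDuminilCopinGuttmann2014, Theorem 2 (arXiv v5 p. 3: y_c = 1 + √2) with Propositions 6–7 (pp. 10–11)] -/
theorem tendsto_stripMuY₂_of_le (hy : 0 < y) (hz : 0 < z) (hy' : y ≤ 1 + Real.sqrt 2) (hz' : z ≤ 1 + Real.sqrt 2) :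
    Tendsto (fun T : ℕ => stripMuY₂ T y z) atTop (𝓝 hexConnectiveConstant) := by
  have h := tendsto_stripMuY₂_atTop hy hz
  rwa [(HV.surfaceMu_eq_iff hy).2 hy', (HV.surfaceMu_eq_iff hz).2 hz', max_self] at h

/-- With the stronger fugacity at the bottom (`z ≤ y`): `μ_T(y,z) → μ(y)`; in particular for `y > 1 + √2` the limit is the
wall-bridge rate `β(y)`. [cite: BeatonBousquetMelouDeGierDuminilCopinGuttmann2014, Proposition 5 (arXiv v5 p. 9: μ(y) non-decreasing) and Proposition 7 (p. 11)] -/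
theorem tendsto_stripMuY₂_of_le_left (hy : 0 < y) (hz : 0 < z) (hzy : z ≤ y) :
    Tendsto (fun T : ℕ => stripMuY₂ T y z) atTop (𝓝 (HV.surfaceMu y)) := by
  have h := tendsto_stripMuY₂_atTop hy hz
  rwa [max_eq_left (HV.surfaceMu_mono hz hzy)] at h

end Literature.Probability.RandomPlanarGeometry.SAW.HexBW
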